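import Summits.BirchSwinnertonDyer.BirchSwinnertonDyer.Theorems.ByReductionTypeAtTwoSupersingularFlatColemanClauses
import Literature.NumberTheory.EllipticCurves.Sprung2012.ColemanPairUniqueProofs
import Literature.NumberTheory.EllipticCurves.Sprung2012.LocalIwasawaModule
import HarnessLib

/-!
# Route `ThetaPartnerAtTwo` (TP2), crux K3 `SignedKatoDivisibilityUpToAtTwo` (item stmt-BirchSwinnertonDyer-20308),
# line `colemanrat` v5 — **Sprung's Coleman map IS a `Λ`-linear map** `Col = (Col♯, Col♭) : H¹_Iw(T) →ₗ[Λ] Λ × Λ` on the points model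
# with the `Λ`-module structure `Sprung2012.moduleOfGenerator` (existence of values: `SSFlatEC.exists_isColemanPair_of_trace`, any `p`,
# levels + the `n ≥ 1` trace relation; uniqueness: `Sprung2012.IsColemanPair.unique`, `p ∣ a_p`; `Λ`-linearity:
# `Sprung2012.isColemanPair_lambdaSMul`). For the registered stub (R2^ι) this is the map `ι_P = Col♭` before passing to the quotient
# `P = H¹_Iw ⧸ Ker Col♭` (on which it is injective by definition).

Lead `bsd-wall-tp2-p2x` g4 (cell `bsd-wall`). HONEST FRAMING: THEOREMS ONLY (existential form; no definition, no named fact, no instance,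
no `sorry`); closes no item; BSD is NOT proved by any of this.

## What is proved
* `exists_colemanLinearMap` — for a local lift `g` of the generator, `p ∣ a_p`, levels `c_n ∈ E(K_n·K_v)` with the `n ≥ 1` trace relation:
  there is a `Λ`-LINEAR `Col : (E(K_∞·K_v) →+ ℤ_p) →ₗ[Λ] Λ × Λ` (module structure `moduleOfGenerator κ ι W hg`) with
  `IsColemanPair … z (Col z).1 (Col z).2` for every `z`, and `Col z = (L♯, L♭)` for every Coleman pair `(L♯, L♭)` of `z`;
  `ker (snd ∘ Col) = colemanKer … .flat` (`mem_colemanKer_flat_iff_of_colemanLinearMap`).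
* `exists_colemanLinearMap_two` — the `p = 2` spelling for a plus Honda system `d` ((L), (TR) `Tr d_{m+2} = −d_m`) at `a₂ = 0`.

References: [Sprung2012] Def. 3.1, Prop. 3.9, Props. 5.3–5.7, Def. 5.9 (pp. 1489–1495); [Sprung2017] Thm. 1.12; [Kobayashi2003] Thm. 6.2.
-/

set_option autoImplicit false
-- the Theorems namespace of this sub repeats the summit name by design (D-0017 nested layout)
set_option linter.dupNamespace false

noncomputable section

open scoped Classical

namespace Summit.BirchSwinnertonDyer.BirchSwinnertonDyer.Theorems

namespace SignedKatoOffTwo.ColemanLinear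

open Literature.NumberTheory.EllipticCurves Literature.NumberTheory.GaloisRepresentations
  Literature.NumberTheory.EllipticCurves.ZpExtension Literature.NumberTheory.EllipticCurves.Kobayashi2003
  Literature.NumberTheory.EllipticCurves.Sprung2012 Literature.NumberTheory.EllipticCurves.Sprung2017

universe u

section General

variable {K : Type u} [Field K] {p : ℕ} [Fact p.Prime] (κ : ZpExtension K p)
  {E : Type u} [Field E] [Algebra K E] (ι : AlgebraicClosure K →ₐ[K] AlgebraicClosure E) (W : WeierstrassCurve K)

/-- **The Coleman map as a `Λ`-linear map** `Col : H¹_Iw(T) →ₗ[Λ] Λ × Λ` on the points model (`Λ`-module structure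
`moduleOfGenerator κ ι W hg`): granted `p ∣ a_p`, levels and the `n ≥ 1` trace relation, there is a `Λ`-linear `Col` whose value at every
functional `z` is a Coleman pair of `z`, equal to every Coleman pair of `z` (uniqueness). [cite: Sprung2012, Def. 5.9 (p. 1495), Prop. 5.7]
[cite: Sprung2017, Thm. 1.12] -/
theorem exists_colemanLinearMap {g : Field.absoluteGaloisGroup E} (hg : κ.IsTopGenerator (resGalOfEmb ι g))
    {ap : ℤ} (hap : (p : ℤ) ∣ ap) {c : ℕ → localPoints W E} (hc : ∀ n, c n ∈ localLayerPointsOfEmb κ ι W n)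
    (hTr : ∀ n, 1 ≤ n → localTraceOfEmb κ ι W n (n + 1) (c (n + 1)) = ap • c n - c (n - 1)) :
    letI := moduleOfGenerator κ ι W hg
    ∃ Col : (localTowerPointsOfEmb κ ι W →+ ℤ_[p]) →ₗ[IwasawaAlgebra p] IwasawaAlgebra p × IwasawaAlgebra p,
      (∀ z, IsColemanPair κ ι W ap g c z (Col z).1 (Col z).2) ∧
      (∀ z Ls Lf, IsColemanPair κ ι W ap g c z Ls Lf → Col z = (Ls, Lf)) := by
  letI := moduleOfGenerator κ ι W hg
  have hex := fun z ↦ SSFlatEC.exists_isColemanPair_of_trace κ ι W hg hap hc hTr z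
  choose Ls Lf hpair using hex
  have huniq : ∀ z Ls' Lf', IsColemanPair κ ι W ap g c z Ls' Lf' → (Ls z, Lf z) = (Ls', Lf') := fun z Ls' Lf' h ↦ by
    obtain ⟨h1, h2⟩ := IsColemanPair.unique κ ι W hap (hpair z) h
    rw [h1, h2]
  refine ⟨{ toFun := fun z ↦ (Ls z, Lf z)
            map_add' := fun z z' ↦ ?_
            map_smul' := fun f z ↦ ?_ }, fun z ↦ hpair z, fun z Ls' Lf' h ↦ huniq z Ls' Lf' h⟩
  · rw [Prod.mk_add_mk]
    exact huniq (z + z') _ _ ((hpair z).add (hpair z'))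
  · rw [RingHom.id_apply, Prod.smul_mk, smul_eq_mul, smul_eq_mul]
    exact huniq (f • z) _ _ (isColemanPair_lambdaSMul hg hc (hpair z) f)

/-- **`Ker Col♭` is the kernel of the ♭-component**: for the linear `Col` of `exists_colemanLinearMap`, `z ∈ colemanKer … .flat` iff
`(Col z).2 = 0`. [cite: Sprung2012, Def. 7.9 (p. 1503)] -/
theorem mem_colemanKer_flat_iff_of_colemanLinearMap {g : Field.absoluteGaloisGroup E} (hg : κ.IsTopGenerator (resGalOfEmb ι g))
    {ap : ℤ} {c : ℕ → localPoints W E}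
    (Col : letI := moduleOfGenerator κ ι W hg;
      (localTowerPointsOfEmb κ ι W →+ ℤ_[p]) →ₗ[IwasawaAlgebra p] IwasawaAlgebra p × IwasawaAlgebra p)
    (hCol : ∀ z, IsColemanPair κ ι W ap g c z (Col z).1 (Col z).2)
    (hCol' : ∀ z Ls Lf, IsColemanPair κ ι W ap g c z Ls Lf → Col z = (Ls, Lf))
    (z : localTowerPointsOfEmb κ ι W →+ ℤ_[p]) :
    z ∈ colemanKer κ ι W ap g c .flat ↔ (Col z).2 = 0 := by
  rw [mem_colemanKer_iff]
  constructor
  · rintro ⟨Ls, Lf, h, h0⟩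
    rw [hCol' z Ls Lf h]
    exact h0
  · intro h
    exact ⟨(Col z).1, (Col z).2, hCol z, h⟩

end General

/-! ## `p = 2`, plus Honda system (`a₂ = 0`) -/

section Two

variable {K : Type u} [Field K] (κ : ZpExtension K 2)
  {E : Type u} [Field E] [Algebra K E] (ι : AlgebraicClosure K →ₐ[K] AlgebraicClosure E) (W : WeierstrassCurve K)

/-- **`Col` is `Λ`-linear at `p = 2` for a plus Honda system** (`(TR) Tr_{m+2/m+1} d_{m+2} = −d_m`, i.e. `a₂ = 0`): the spelling consumed by
K3's points model (HONDA⁺@2 = `Cruxes.SignedControlAtTwo.EulerChar.stub_plusHondaSystemTwo`). [cite: Sprung2012, Def. 5.9 (p. 1495), Thm. 2.2 (2′)]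
[cite: Kobayashi2003, Thm. 6.2 (p. 11)] -/
theorem exists_colemanLinearMap_two {g : Field.absoluteGaloisGroup E} (hg : κ.IsTopGenerator (resGalOfEmb ι g))
    {d : ℕ → localPoints W E} (hd : ∀ m, d m ∈ localLayerPointsOfEmb κ ι W m)
    (htr : ∀ m, localTraceOfEmb κ ι W (m + 1) (m + 2) (d (m + 2)) = -d m) :
    letI := moduleOfGenerator κ ι W hg
    ∃ Col : (localTowerPointsOfEmb κ ι W →+ ℤ_[2]) →ₗ[IwasawaAlgebra 2] IwasawaAlgebra 2 × IwasawaAlgebra 2,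
      (∀ z, IsColemanPair κ ι W 0 g d z (Col z).1 (Col z).2) ∧
      (∀ z Ls Lf, IsColemanPair κ ι W 0 g d z Ls Lf → Col z = (Ls, Lf)) := by
  refine exists_colemanLinearMap κ ι W hg (dvd_zero _) hd fun n hn ↦ ?_
  obtain ⟨m, rfl⟩ := Nat.exists_eq_add_of_le' hn
  have h := htr m
  rw [zero_smul, zero_sub]
  simpa [Nat.add_sub_cancel] using h

end Two

end SignedKatoOffTwo.ColemanLinear

end Summit.BirchSwinnertonDyer.BirchSwinnertonDyer.Theorems

end
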